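import Literature.Geometry.Lorentzian.RiemannianMeasureDensity
import Literature.Geometry.Lorentzian.GreenIdentity
import HarnessLib

/-!
# The density `dV_{h₁}/dV_{h₂} = √det(h₂⁻¹ h₁)` of two Riemannian measures and volume comparison
# for uniformly equivalent metrics

For two `C^n` Riemannian metrics `h₁, h₂` on a manifold `N` modelled on `ℝ^m`, the ratio of the
volume densities `√det (h₁)_{ij} / √det (h₂)_{ij}` in a chart is the chart-independent function
`ρ = √(det (h₂⁻¹ h₁))` on `N`, where `h₂⁻¹ h₁` is the field of endomorphisms
`T_p = ♯_{h₂} ∘ ♭_{h₁} : T_pN → T_pN` (`h₂(T_p v, w) = h₁(v, w)`); hence `dV_{h₁} = ρ dV_{h₂}`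
(Chavel 2006, §III.3, (III.3.5)–(III.3.6); Topping 2006, Prop. 2.3.12 for families of metrics).
`RiemannianMeasureDensity.lean` proves `dV_{h₁} = ρ dV_{h₂}` on a *compact* manifold for any `ρ`
satisfying the chart identity. This file

* identifies the density intrinsically: `det (h₁)_{ij}(y) = det T_{φ⁻¹y} · det (h₂)_{ij}(y)` on
  every chart target (`det_chartGramMatrix_eq_det_endo_mul`: both Gram matrices are
  `BilinForm.toMatrix` in the coordinate basis and `h₁ = h₂ ∘ (T × id)`,
  `LinearMap.BilinForm.toMatrix_compLeft`), so that `det T > 0` and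
  `√det (h₁)_{ij} = √(det T) √det (h₂)_{ij}` (`sqrt_det_chartGramMatrix_eq_mul`), and `√(det T)`
  is continuous (`continuous_sqrt_det_endo`);
* removes the compactness: on a second-countable manifold `dV_{h₁} = ρ dV_{h₂}` for any measurable
  `ρ` satisfying the chart identity (`riemannianMeasure_eq_withDensity_of_chartGram'`, finite chart
  covers as in the compact case plus an exhaustion by a countable chart cover), hence
  `dV_{h₁} = √(det (h₂⁻¹h₁)) dV_{h₂}` (`riemannianMeasure_eq_withDensity_sqrt_det_endo`);
* derives the **volume comparison of uniformly equivalent metrics**: if `det (h₂⁻¹ h₁) ≤ C²`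
  pointwise then `dV_{h₁} ≤ C dV_{h₂}` as measures
  (`riemannianMeasure_le_smul_of_det_endo_le`).

This is the measure-theoretic input for the uniformity in `t` of the constants of Schoen–Yau 1979,
§3 along the family `ds² + t Ric` (Comm. Math. Phys. 65, pp. 72–74, (3.28)–(3.29)), combined with
`sobolev_of_uniformlyEquivalent` (`MetricComparison.lean`). All results are proved; no
definitions and no named facts are introduced.

## References

* I. Chavel, *Riemannian Geometry: A Modern Introduction*, 2nd ed., CUP 2006, §III.3,
  (III.3.5)–(III.3.6). [Chavel2006]
* P. Topping, *Lectures on the Ricci flow*, LMS LNS 325, CUP 2006, Prop. 2.3.12. [Topping2006]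
* R. Schoen, S.-T. Yau, Comm. Math. Phys. 65 (1979) 45–76, (3.28)–(3.29) (p. 73). [SchoenYauPMT1979]
-/

noncomputable section

open Manifold Bundle MeasureTheory Measure Set Filter Function TopologicalSpace
open scoped ContDiff Topology ENNReal Matrix

namespace Literature.Geometry.Lorentzian

open PseudoRiemannianMetric

variable {H : Type*} [TopologicalSpace H] {n : ℕ∞ω} {m : ℕ}
  {I : ModelWithCorners ℝ (EuclideanSpace ℝ (Fin m)) H}
  {N : Type*} [TopologicalSpace N] [ChartedSpace H N]

/-! ### The density `det (h₂⁻¹ h₁)` and the Gram determinants in a chart -/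

section Density

variable [IsManifold I ∞ N]
  (h₁ h₂ : ContMDiffRiemannianMetric I n (EuclideanSpace ℝ (Fin m)) (TangentSpace I : N → Type _))

/-- `h₁ = h₂ ∘ (T × id)` for the endomorphism `T = ♯_{h₂} ∘ ♭_{h₁}`: the bilinear form of `h₁`
at `p` is the left composition of that of `h₂` with `T_p`. [folklore] -/
theorem toBilinForm_eq_compLeft_sharp_comp (p : N) :
    (ofRiemannian h₁).toBilinForm p =
      ((ofRiemannian h₂).toBilinForm p).compLeft
        (((ofRiemannian h₂).sharp p).toLinearMap ∘ₗ (ofRiemannian h₁).toBilinForm p) := by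
  refine LinearMap.ext fun v ↦ LinearMap.ext fun w ↦ ?_
  rw [LinearMap.BilinForm.compLeft_apply]
  simp only [LinearMap.coe_comp, LinearEquiv.coe_coe, Function.comp_apply, toBilinForm_apply,
    val_sharp_apply]

/-- **The Gram determinants of two metrics in a chart differ by `det (h₂⁻¹ h₁)`**: for `y` in
the target of the extended chart at `x` and `p = φ⁻¹ y`,
`det (h₁)_{ij}(y) = det T_p · det (h₂)_{ij}(y)` with `T_p = ♯_{h₂} ∘ ♭_{h₁}` — both Gram matrices
are the matrices of the forms in the coordinate basis of `T_pN`, and `h₁ = h₂ ∘ (T × id)`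
(`LinearMap.BilinForm.toMatrix_compLeft`, `LinearMap.det_toMatrix`).
[cite: Chavel2006, §III.3 (III.3.5)–(III.3.6)] -/
theorem det_chartGramMatrix_eq_det_endo_mul (x : N) {y : EuclideanSpace ℝ (Fin m)}
    (hy : y ∈ (extChartAt I x).target) :
    (chartGramMatrix h₁ x y).det =
      LinearMap.det (((ofRiemannian h₂).sharp ((extChartAt I x).symm y)).toLinearMap ∘ₗ
          (ofRiemannian h₁).toBilinForm ((extChartAt I x).symm y)) *
        (chartGramMatrix h₂ x y).det := by
  classical
  set p : N := (extChartAt I x).symm y with hp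
  have hps : p ∈ (chartAt H x).source := by
    rw [← extChartAt_source I]
    exact (extChartAt I x).map_target hy
  have hpe : p ∈ (trivializationAt (EuclideanSpace ℝ (Fin m)) (TangentSpace I) x).baseSet := by
    simpa using hps
  set β : Module.Basis (Fin m) ℝ (TangentSpace I p) :=
    (trivializationAt (EuclideanSpace ℝ (Fin m)) (TangentSpace I) x).basisAt
      (EuclideanSpace.basisFun (Fin m) ℝ).toBasis hpe with hβ
  have hβi : ∀ i, (trivializationAt (EuclideanSpace ℝ (Fin m)) (TangentSpace I) x).localFrame
      (EuclideanSpace.basisFun (Fin m) ℝ).toBasis i p = β i := fun i ↦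
    Trivialization.localFrame_apply_of_mem_baseSet _ _ hpe
  have hG : ∀ h : ContMDiffRiemannianMetric I n (EuclideanSpace ℝ (Fin m)) (TangentSpace I : N → Type _),
      chartGramMatrix h x y = LinearMap.BilinForm.toMatrix β ((ofRiemannian h).toBilinForm p) := by
    intro h
    ext i j
    rw [LinearMap.BilinForm.toMatrix_apply, toBilinForm_apply,
      chartGramMatrix_apply_eq_val_localFrame h x hy i j, ← hp, hβi i, hβi j]
  rw [hG h₁, hG h₂, toBilinForm_eq_compLeft_sharp_comp h₁ h₂ p,
    LinearMap.BilinForm.toMatrix_compLeft, Matrix.det_mul, Matrix.det_transpose,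
    LinearMap.det_toMatrix, ← toBilinForm_eq_compLeft_sharp_comp h₁ h₂ p]

/-- **`det (h₂⁻¹ h₁) > 0`** (both Gram determinants are positive). [folklore] -/
theorem det_endo_pos (p : N) :
    0 < LinearMap.det (((ofRiemannian h₂).sharp p).toLinearMap ∘ₗ (ofRiemannian h₁).toBilinForm p) := by
  have hy : extChartAt I p p ∈ (extChartAt I p).target := (extChartAt I p).map_source
    (mem_extChartAt_source p)
  have h := det_chartGramMatrix_eq_det_endo_mul h₁ h₂ p hy
  rw [(extChartAt I p).left_inv (mem_extChartAt_source p)] at h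
  have h1 : 0 < (chartGramMatrix h₁ p (extChartAt I p p)).det :=
    Real.sqrt_pos.1 (sqrt_det_chartGramMatrix_pos h₁ p hy)
  have h2 : 0 < (chartGramMatrix h₂ p (extChartAt I p p)).det :=
    Real.sqrt_pos.1 (sqrt_det_chartGramMatrix_pos h₂ p hy)
  rw [h] at h1
  exact pos_of_mul_pos_left h1 h2.le

/-- **The volume densities differ by `√det (h₂⁻¹ h₁)`**: on the target of the chart at `x`,
`√det (h₁)_{ij}(y) = √(det T_{φ⁻¹ y}) · √det (h₂)_{ij}(y)`.
[cite: Chavel2006, §III.3 (III.3.5)–(III.3.6)] -/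
theorem sqrt_det_chartGramMatrix_eq_mul (x : N) {y : EuclideanSpace ℝ (Fin m)}
    (hy : y ∈ (extChartAt I x).target) :
    Real.sqrt (chartGramMatrix h₁ x y).det =
      Real.sqrt (LinearMap.det (((ofRiemannian h₂).sharp ((extChartAt I x).symm y)).toLinearMap ∘ₗ
          (ofRiemannian h₁).toBilinForm ((extChartAt I x).symm y))) *
        Real.sqrt (chartGramMatrix h₂ x y).det := by
  rw [det_chartGramMatrix_eq_det_endo_mul h₁ h₂ x hy,
    Real.sqrt_mul (det_endo_pos h₁ h₂ _).le]

/-- **The density `√det (h₂⁻¹ h₁)` is continuous**: on the source of the chart at `x` it is the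
quotient of the continuous, positive chart densities `√det (h₁)_{ij} / √det (h₂)_{ij}` composed
with the chart. [folklore] -/
theorem continuous_sqrt_det_endo :
    Continuous fun p : N ↦ Real.sqrt (LinearMap.det
      (((ofRiemannian h₂).sharp p).toLinearMap ∘ₗ (ofRiemannian h₁).toBilinForm p)) := by
  set ρ : N → ℝ := fun p ↦ Real.sqrt (LinearMap.det
    (((ofRiemannian h₂).sharp p).toLinearMap ∘ₗ (ofRiemannian h₁).toBilinForm p)) with hρ
  refine continuous_iff_continuousAt.2 fun x ↦ ?_
  have hsrc : (extChartAt I x).source ∈ 𝓝 x := extChartAt_source_mem_nhds x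
  -- on the chart source, `ρ = (√det G₁ / √det G₂) ∘ φ`
  set F : EuclideanSpace ℝ (Fin m) → ℝ := fun y ↦
    Real.sqrt (chartGramMatrix h₁ x y).det / Real.sqrt (chartGramMatrix h₂ x y).det with hF
  have hFc : ContinuousOn F (extChartAt I x).target := by
    refine (continuousOn_sqrt_det_chartGramMatrix h₁ x).div
      (continuousOn_sqrt_det_chartGramMatrix h₂ x) fun y hy ↦ ?_
    exact (sqrt_det_chartGramMatrix_pos h₂ x hy).ne'
  have heq : ∀ p ∈ (extChartAt I x).source, ρ p = F (extChartAt I x p) := by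
    intro p hp
    have hy : extChartAt I x p ∈ (extChartAt I x).target := (extChartAt I x).map_source hp
    have h := sqrt_det_chartGramMatrix_eq_mul h₁ h₂ x hy
    rw [(extChartAt I x).left_inv hp] at h
    simp only [hF, hρ]
    rw [h, mul_div_assoc, div_self (sqrt_det_chartGramMatrix_pos h₂ x hy).ne', mul_one]
  have hcomp : ContinuousOn (fun p ↦ F (extChartAt I x p)) (extChartAt I x).source :=
    hFc.comp (continuousOn_extChartAt x) fun p hp ↦ (extChartAt I x).map_source hp
  have hρc : ContinuousOn ρ (extChartAt I x).source := hcomp.congr fun p hp ↦ heq p hp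
  exact hρc.continuousAt hsrc

end Density

/-! ### `dV_{h₁} = ρ dV_{h₂}` without compactness -/

section Global

variable [IsManifold I ∞ N] [T3Space N] [MeasurableSpace N] [BorelSpace N]

/-- The density identity on measurable sets covered by finitely many chart sources (the
induction of `riemannianMeasure_eq_withDensity_of_chartGram`, which does not use compactness).
[cite: Chavel2006, §III.3 (III.3.5)–(III.3.6)] -/
theorem riemannianMeasure_eq_withDensity_apply_of_subset_biUnion
    (h₁ h₂ : ContMDiffRiemannianMetric I n (EuclideanSpace ℝ (Fin m)) (TangentSpace I : N → Type _))
    {ρ : N → ℝ≥0∞} (hρ : Measurable ρ)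
    (hpt : ∀ (x : N) (y : EuclideanSpace ℝ (Fin m)), y ∈ (extChartAt I x).target →
      ENNReal.ofReal (Real.sqrt (chartGramMatrix h₁ x y).det) =
        ρ ((extChartAt I x).symm y) * ENNReal.ofReal (Real.sqrt (chartGramMatrix h₂ x y).det))
    (T : Finset N) {A : Set N} (hA : MeasurableSet A)
    (hAT : A ⊆ ⋃ x ∈ T, (extChartAt I x).source) :
    riemannianMeasure h₁ A = (riemannianMeasure h₂).withDensity ρ A := by
  classical
  induction T using Finset.induction_on generalizing A with
  | empty =>
    have hA0 : A = ∅ := subset_empty_iff.1 (by simpa using hAT)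
    subst hA0
    simp
  | insert x T hxT ih =>
    have hsrc : MeasurableSet (extChartAt I x).source := (isOpen_extChartAt_source x).measurableSet
    have hsplit : A = (A ∩ (extChartAt I x).source) ∪ (A \ (extChartAt I x).source) :=
      (inter_union_sdiff _ _).symm
    have hdisj : Disjoint (A ∩ (extChartAt I x).source) (A \ (extChartAt I x).source) :=
      disjoint_left.2 fun z hz hz' ↦ hz'.2 hz.2
    have hrest : A \ (extChartAt I x).source ⊆ ⋃ y ∈ T, (extChartAt I y).source := by
      intro z hz
      have hz' := hAT hz.1
      rw [Finset.set_biUnion_insert, mem_union] at hz'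
      exact hz'.resolve_left hz.2
    rw [hsplit, measure_union hdisj (hA.diff hsrc), measure_union hdisj (hA.diff hsrc),
      riemannianMeasure_eq_withDensity_apply_of_subset_source h₁ h₂ hρ x (hpt x) (hA.inter hsrc)
        inter_subset_right, ih (hA.diff hsrc) hrest]

/-- **`dV_{h₁} = ρ dV_{h₂}` on a second-countable manifold** (`riemannianMeasure_eq_withDensity_of_chartGram`
without the compactness of `N`): a countable family of chart sources covers `N`; every measurable
set is the increasing union of its pieces covered by finitely many of them, on which the two
measures agree, and both measures are continuous from below.
[cite: Chavel2006, §III.3 (III.3.5)–(III.3.6)] -/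
theorem riemannianMeasure_eq_withDensity_of_chartGram' [SecondCountableTopology N]
    (h₁ h₂ : ContMDiffRiemannianMetric I n (EuclideanSpace ℝ (Fin m)) (TangentSpace I : N → Type _))
    {ρ : N → ℝ≥0∞} (hρ : Measurable ρ)
    (hpt : ∀ (x : N) (y : EuclideanSpace ℝ (Fin m)), y ∈ (extChartAt I x).target →
      ENNReal.ofReal (Real.sqrt (chartGramMatrix h₁ x y).det) =
        ρ ((extChartAt I x).symm y) * ENNReal.ofReal (Real.sqrt (chartGramMatrix h₂ x y).det)) :
    riemannianMeasure h₁ = (riemannianMeasure h₂).withDensity ρ := by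
  classical
  refine Measure.ext fun A hA ↦ ?_
  rcases isEmpty_or_nonempty N with hN | hN
  · rw [eq_empty_of_isEmpty A]
    simp
  -- a countable cover by chart sources, enumerated by `ℕ`
  obtain ⟨T, hTc, hTU⟩ := TopologicalSpace.isOpen_iUnion_countable
    (fun x : N ↦ (extChartAt I x).source) fun x ↦ isOpen_extChartAt_source x
  have hTuniv : ⋃ x ∈ T, (extChartAt I x).source = univ := by
    rw [hTU]
    exact iUnion_eq_univ_iff.2 fun z ↦ ⟨z, mem_extChartAt_source z⟩
  have hTne : T.Nonempty := by
    by_contra hT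
    rw [Set.not_nonempty_iff_eq_empty] at hT
    rw [hT] at hTuniv
    simp only [mem_empty_iff_false, iUnion_of_empty, iUnion_empty] at hTuniv
    exact (empty_ne_univ hTuniv)
  obtain ⟨c, hc⟩ := hTc.exists_eq_range hTne
  -- the exhaustion `A_k = A ∩ ⋃_{i ≤ k} source (c i)`
  set S : ℕ → Set N := fun k ↦ ⋃ i ∈ Finset.range (k + 1), (extChartAt I (c i)).source with hS
  have hSm : ∀ k, MeasurableSet (S k) := fun k ↦
    MeasurableSet.biUnion (Finset.range (k + 1)).countable_toSet fun i _ ↦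
      (isOpen_extChartAt_source _).measurableSet
  have hSmono : Monotone S := by
    intro k l hkl z hz
    simp only [hS, mem_iUnion, Finset.mem_range, exists_prop] at hz ⊢
    obtain ⟨i, hi, hzi⟩ := hz
    exact ⟨i, by omega, hzi⟩
  have hSU : ⋃ k, S k = univ := by
    refine eq_univ_of_forall fun z ↦ ?_
    have hz : z ∈ ⋃ x ∈ T, (extChartAt I x).source := by rw [hTuniv]; exact mem_univ z
    simp only [mem_iUnion, exists_prop] at hz
    obtain ⟨x, hxT, hzx⟩ := hz
    rw [hc] at hxT
    obtain ⟨i, rfl⟩ := hxT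
    refine mem_iUnion.2 ⟨i, ?_⟩
    simp only [hS, mem_iUnion, Finset.mem_range, exists_prop]
    exact ⟨i, by omega, hzx⟩
  have hAk : ∀ k, riemannianMeasure h₁ (A ∩ S k) = (riemannianMeasure h₂).withDensity ρ (A ∩ S k) := by
    intro k
    refine riemannianMeasure_eq_withDensity_apply_of_subset_biUnion h₁ h₂ hρ hpt
      ((Finset.range (k + 1)).image c) (hA.inter (hSm k)) ?_
    intro z hz
    have hz2 := hz.2
    simp only [hS, mem_iUnion, Finset.mem_range, exists_prop] at hz2
    obtain ⟨i, hi, hzi⟩ := hz2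
    simp only [mem_iUnion, Finset.mem_image, Finset.mem_range, exists_prop]
    exact ⟨c i, ⟨i, hi, rfl⟩, hzi⟩
  have hmono : Monotone fun k ↦ A ∩ S k := fun k l hkl ↦ inter_subset_inter_right _ (hSmono hkl)
  have hAU : A = ⋃ k, A ∩ S k := by rw [← inter_iUnion, hSU, inter_univ]
  have h1 := tendsto_measure_iUnion_atTop (μ := riemannianMeasure h₁) hmono
  have h2 := tendsto_measure_iUnion_atTop (μ := (riemannianMeasure h₂).withDensity ρ) hmono
  rw [← hAU] at h1 h2
  exact tendsto_nhds_unique (h1.congr hAk) h2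

variable [SecondCountableTopology N]
  (h₁ h₂ : ContMDiffRiemannianMetric I n (EuclideanSpace ℝ (Fin m)) (TangentSpace I : N → Type _))

/-- **`dV_{h₁} = √det (h₂⁻¹ h₁) dV_{h₂}`**: the Riemannian measure of `h₁` is that of `h₂` with the
continuous density `p ↦ √det T_p`, `T_p = ♯_{h₂} ∘ ♭_{h₁}` (on a second-countable manifold
modelled on `ℝ^m`). Chavel 2006, §III.3; Topping 2006, Prop. 2.3.12.
[cite: Chavel2006, §III.3 (III.3.5)–(III.3.6)] -/
theorem riemannianMeasure_eq_withDensity_sqrt_det_endo :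
    riemannianMeasure h₁ = (riemannianMeasure h₂).withDensity fun p ↦ ENNReal.ofReal
      (Real.sqrt (LinearMap.det
        (((ofRiemannian h₂).sharp p).toLinearMap ∘ₗ (ofRiemannian h₁).toBilinForm p))) :=
  riemannianMeasure_eq_withDensity_of_chartGram' h₁ h₂
    (ENNReal.measurable_ofReal.comp (continuous_sqrt_det_endo h₁ h₂).measurable)
    fun x y hy ↦ by
      rw [sqrt_det_chartGramMatrix_eq_mul h₁ h₂ x hy, ENNReal.ofReal_mul (Real.sqrt_nonneg _)]

/-- **Volume comparison for uniformly equivalent metrics**: if `det (h₂⁻¹ h₁) ≤ C²` pointwise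
(`C ≥ 0`), then `dV_{h₁} ≤ C dV_{h₂}` as measures. With `sobolev_of_uniformlyEquivalent`
(`MetricComparison.lean`) this makes the Sobolev constant of Schoen–Yau 1979, Lemma 3.1 uniform
along a family of uniformly equivalent metrics ((3.28)–(3.29), p. 73).
[cite: SchoenYauPMT1979, (3.28)–(3.29) (p. 73)] -/
theorem riemannianMeasure_le_smul_of_det_endo_le {C : ℝ} (hC : 0 ≤ C)
    (hle : ∀ p : N, LinearMap.det
      (((ofRiemannian h₂).sharp p).toLinearMap ∘ₗ (ofRiemannian h₁).toBilinForm p) ≤ C ^ 2) :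
    riemannianMeasure h₁ ≤ ENNReal.ofReal C • riemannianMeasure h₂ := by
  rw [riemannianMeasure_eq_withDensity_sqrt_det_endo h₁ h₂, ← withDensity_const]
  refine withDensity_mono (ae_of_all _ fun p ↦ ENNReal.ofReal_le_ofReal ?_)
  calc Real.sqrt (LinearMap.det (((ofRiemannian h₂).sharp p).toLinearMap ∘ₗ
        (ofRiemannian h₁).toBilinForm p)) ≤ Real.sqrt (C ^ 2) := Real.sqrt_le_sqrt (hle p)
    _ = C := Real.sqrt_sq hC

end Global

end Literature.Geometry.Lorentzian

end
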